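/-
Copyright (c) 2026 the pub-hodgecm-mathlib formalisation cell (harness21).  Prover seat hodgecm-mathlib-K2E1-p02 (g4), Track B ∕ K2-LIT, h413 =
`stmt-HodgeConjecture-24833`, line `K2_E1_TraceFormulaBeta`, campaign «RES-RANK-ONE»; DEAL (H4-prep) of the dealer K2E1-plan (g2) 2026-09-04T02:36:00Z:
the CONJUGATION LAW of the constant-term functional under rational normalisers of the radical (left `P(F)`-invariance of `φ_P` once the modulus is `1`), and the
torus reading that carries the exponents of the next brick (H4).
-/
import Summits.HodgeConjecture.HodgeConjecture.Theorems.K2E1ResidualConstantTermFunctional    -- ★ p856826∕p856838 (this seat): (H3) + right-`N_i(𝔸)`-invariance ∕ `𝓕`-independence of `CT_𝓕`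
import HarnessLib

/-!
# K2·E1 — `K2E1ConstantTermTorusU`: THE CONSTANT-TERM FUNCTIONAL UNDER RATIONAL NORMALISERS OF THE RADICAL — `CT_𝓕 ψ (x·γ) = CT_𝓕 ψ (x)` WHEN CONJUGATION
# BY `γ ∈ G(K)` PRESERVES THE HAAR MEASURE OF `N_i(𝔸)` (campaign «RES-RANK-ONE», brick (H4-prep))

Track B ∕ K2-LIT, crux h413 = `stmt-HodgeConjecture-24833`, route of record `HCCMUnconditional`; cell `hodgecm-mathlib`, squad K2, ENGINE E1; live sockets 5Res ∕ 12R3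
read «⟸ (FD) `L²_res(U(Φ_N))` is `K`-admissible» (★ p856793).  Prover seat `hodgecm-mathlib-K2E1-p02` (g4); DEAL (H4-prep) of the dealer K2E1-plan (g2)
2026-09-04T02:36:00Z.  THEOREMS ONLY (no `def`, no `instance`, no notation, no named-fact hypothesis, no `sorry`); lane `--supports stmt-HodgeConjecture-24833 --as helper`
(count-neutral).  Closes no socket.

CURRENCY (as in ★ `K2E1ResidualConstantTermFunctional`, = ★ `ConstantTermVanishes`, = K2E1-p09 (g3)'s ★ `CT_𝓕`): for a function `ψ` on `G(𝔸) ⧸ Q` (`Q = A_G G(K)`), a radical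
`N_i(𝔸) = 𝔓.radical i`, a Haar measure `ν_N` on it and a fundamental domain `𝓕` of `N_i(K) = 𝔓.rational i`, the constant term at `x ∈ G(𝔸)` is
`CT_𝓕 ψ (x) = ∫_𝓕 ψ((x u⁻¹)Q) dν_N(u)`; classically, with `φ_cl(g) = ψ(g⁻¹Q)`, `CT_𝓕 ψ (x) = φ_P(x⁻¹)`, so invariance of `x ↦ CT_𝓕 ψ (x)` under RIGHT multiplication by a
set `S` is LEFT-`S⁻¹`-invariance of `φ_P`.

WHAT.
* §1 (cited, not re-derived): RIGHT-`N_i(𝔸)`-invariance and `𝓕`-independence of `x ↦ CT_𝓕 ψ (x)` are ★ p856838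
  `K2E1ResidualConstantTermFunctional.setIntegral_constantTerm_mul_radical_eq` ∕ `…_eq_of_isFundamentalDomain`.
* §2 **THE CONJUGATION LAW** `setIntegral_constantTerm_mul_eq_of_conj` (generic ★ datum, ONE STEP — it never opens the radical, so it serves the Siegel radical of
  `U(Φ₂)` and the HEISENBERG radical of `U(Φ₃)` alike): let `γ ∈ G(K)` (★ `arithmeticSubgroup`; e.g. a rational point of the parabolic) NORMALISE `N_i(𝔸)` through a measurable equivalence `c`
  of `N_i(𝔸)` with `c(u) = γuγ⁻¹`, and suppose `c` PRESERVES the Haar measure `ν_N` (MODULUS ONE — the hypothesis of record; for `U(Φ_N)` and `γ` in the rational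
  torus it is the product formula `|δ_P(γ)|_𝔸 = 1`, ★ `traceZeroModulus_eq_one_of_mem_principalIdeles` ∕ ★ `UnitaryGroupBorelModulusTwo`∕`Three` currency).  THEN
  `CT_𝓕 ψ (x·γ) = CT_𝓕 ψ (x)` for EVERY fundamental domain `𝓕` and every `x`: `(xγu⁻¹)Q = (xγu⁻¹γ⁻¹)Q = (x·(c u)⁻¹)Q` (`γ⁻¹ ∈ Q`), change of variables along the
  measure-preserving `c` (Mathlib `MeasurePreserving.setIntegral_image_emb`), `c(𝓕)` is again a fundamental domain of `N_i(K)` (Mathlib `IsFundamentalDomain.image_of_equiv`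
  with the group automorphism `δ ↦ γ⁻¹δγ` of `N_i(K)`), and ★ `𝓕`-independence.  Auxiliary: `coe_symm_conj` (`c⁻¹(w) = γ⁻¹wγ`), `isFundamentalDomain_image_conj`.
  With ★ p856838 this is the classical «`φ_P` is left-`N(𝔸)P(F)`-invariant» [MoeglinWaldspurger1995 I.2.6; BorelJacquet1979 §4.4], modulo the modulus-one discharge.
* §3 THE TORUS READING — TARGET SHAPE FOR (H4) (docstring formula, no socket, dealer 02:36:00Z).  For the archimedean ray `a_r` of the split torus (★ `coneEltU2 L r` for
  `U(Φ₂)`, the cone element of ★ `exists_ray_of_mem_cmSiegelConeU_three` for `U(Φ₃)`) there is NO same-`𝓕` conjugation identity (`a_r⁻¹ N_i(K) a_r ⊄ N_i(K)`; conjugation by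
  `a_r` scales `ν_N` by the `δ_P`-type factor ★ `traceZeroModulus`, `a n(b) a⁻¹ = n(r²b)` ★ `coneEltU2_mul_unipotent_mul_inv`); the object carrying the EXPONENTS is the
  FUNCTION `r ↦ CT_𝓕(S_η w)(x · a_r)` (`S_η w` the smooth vectors of ★ p856826, `w` in the `τ`-isotypic residual vectors), normalised by `δ_P(a_r)^{-1/2}`.  (H4)'s ONE
  hypothesis reads: «for a fixed `K`-type `τ` these functions lie in a FINITE-DIMENSIONAL space of exponent sums `Σ_{s ∈ E(τ)} c_s(x) r^{s} (log r)^{≤ d}`» — the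
  finiteness clause of rank-one Borel Eisenstein theory [MoeglinWaldspurger1995 IV.1.11, V.3.13; Langlands1976 §7] — whence (FD) by the joint injectivity of ★ p856826
  `eq_of_forall_constantTermVanishes_sub` and the compactness of `M(F)A_M∖M(𝔸)` at `N = 2, 3`, and the sockets by ★ p856793.
HONEST LABEL: HC_CM is proved only modulo the 7 printed citations (2 remaining named inputs: hLiu418 = `stmt-HodgeConjecture-24832`, h413 =
`stmt-HodgeConjecture-24833`) until rung 0 closes; this file asserts no named fact and closes no socket; the modulus-one discharge for `U(Φ_N)` is NOT in this file.
References: [MoeglinWaldspurger1995] C. Mœglin, J.-L. Waldspurger, *Spectral Decomposition and Eisenstein Series* (1995), I.2.6, IV.1.11, V.3.13 · [BorelJacquet1979]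
A. Borel, H. Jacquet, Corvallis PSPM 33.1 (1979), §4.4–4.6 · [Langlands1976] R. P. Langlands, *On the Functional Equations Satisfied by Eisenstein Series*, LNM 544
(1976), §7 · [GetzHahn2024] J. R. Getz, H. Hahn, *An Introduction to Automorphic Representations* (2024), §9.5, Lemma 9.2.6.
-/

set_option autoImplicit false
-- the mandated namespace repeats the single-problem summit's segment (`HodgeConjecture.HodgeConjecture`)
set_option linter.dupNamespace false

noncomputable section

open MeasureTheory Measure Filter Topology Set
open scoped ENNReal Pointwise
open Literature.NumberTheory.Automorphic AdelicGroupData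
open Summit.HodgeConjecture.HodgeConjecture.Cruxes.H413.K2E1ResidualConstantTermFunctional

namespace Summit.HodgeConjecture.HodgeConjecture.Cruxes.H413.K2E1ConstantTermTorusU

universe u

/-! ## §2 The conjugation law: `CT_𝓕 ψ (x·γ) = CT_𝓕 ψ (x)` for rational normalisers of modulus one -/

section Conj

variable {K : Type} [Field K] [NumberField K] {𝒢 : AdelicGroupData.{u} K} (𝔓 : 𝒢.ParabolicUnipotentData) {i : 𝔓.ι}
  [MeasurableSpace (𝔓.radical i)]

/-- If a measurable equivalence `c` of `N_i(𝔸)` is conjugation by `γ` (`c(u) = γuγ⁻¹`), then its inverse is conjugation by `γ⁻¹`: `c⁻¹(w) = γ⁻¹wγ`. [folklore] -/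
theorem coe_symm_conj {γ : 𝒢.Adelic} (c : 𝔓.radical i ≃ᵐ 𝔓.radical i)
    (hc : ∀ u : 𝔓.radical i, ((c u : 𝔓.radical i) : 𝒢.Adelic) = γ * (u : 𝒢.Adelic) * γ⁻¹) (w : 𝔓.radical i) :
    ((c.symm w : 𝔓.radical i) : 𝒢.Adelic) = γ⁻¹ * (w : 𝒢.Adelic) * γ := by
  have h := hc (c.symm w)
  rw [c.apply_symm_apply] at h
  rw [h]
  group

/-- **The conjugate `c(𝓕) = γ𝓕γ⁻¹` of a fundamental domain of `N_i(K)` is again a fundamental domain**, for a rational `γ` normalising `N_i(𝔸)` whose conjugation preserves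
`ν_N` (Mathlib `IsFundamentalDomain.image_of_equiv`, the group automorphism of `N_i(K)` being `δ ↦ γ⁻¹δγ`). [cite: MoeglinWaldspurger1995, I.2.6] -/
theorem isFundamentalDomain_image_conj (νN : Measure (𝔓.radical i)) {γ : 𝒢.Adelic} (hγ : γ ∈ 𝒢.arithmeticSubgroup)
    (c : 𝔓.radical i ≃ᵐ 𝔓.radical i) (hc : ∀ u : 𝔓.radical i, ((c u : 𝔓.radical i) : 𝒢.Adelic) = γ * (u : 𝒢.Adelic) * γ⁻¹)
    (hcν : MeasurePreserving c νN νN) {𝓕 : Set (𝔓.radical i)} (h𝓕 : IsFundamentalDomain (𝔓.rational i) 𝓕 νN) :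
    IsFundamentalDomain (𝔓.rational i) (c '' 𝓕) νN := by
  -- the automorphism `δ ↦ γ⁻¹ δ γ` of `N_i(K)` and its inverse `δ ↦ γ δ γ⁻¹` (rational points go to rational points)
  have hmemQ : ∀ {w : 𝔓.radical i}, (w : 𝒢.Adelic) ∈ 𝒢.arithmeticSubgroup → ((c.symm w : 𝔓.radical i) : 𝒢.Adelic) ∈ 𝒢.arithmeticSubgroup := by
    intro w hw
    rw [coe_symm_conj 𝔓 c hc w]
    exact Subgroup.mul_mem _ (Subgroup.mul_mem _ (Subgroup.inv_mem _ hγ) hw) hγ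
  have hmemQ' : ∀ {w : 𝔓.radical i}, (w : 𝒢.Adelic) ∈ 𝒢.arithmeticSubgroup → ((c w : 𝔓.radical i) : 𝒢.Adelic) ∈ 𝒢.arithmeticSubgroup := by
    intro w hw
    rw [hc w]
    exact Subgroup.mul_mem _ (Subgroup.mul_mem _ hγ hw) (Subgroup.inv_mem _ hγ)
  let e : 𝔓.rational i ≃ 𝔓.rational i :=
    { toFun := fun δ => ⟨c.symm δ, hmemQ δ.2⟩
      invFun := fun δ => ⟨c δ, hmemQ' δ.2⟩
      left_inv := fun δ => Subtype.ext (c.apply_symm_apply _)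
      right_inv := fun δ => Subtype.ext (c.symm_apply_apply _) }
  have hqmp : Measure.QuasiMeasurePreserving c.toEquiv.symm νN νN := by
    rw [MeasurableEquiv.coe_toEquiv_symm]
    exact hcν.symm.quasiMeasurePreserving
  refine h𝓕.image_of_equiv c.toEquiv hqmp e fun δ u => ?_
  -- `c (e δ • u) = δ • c u`
  change c.toEquiv (((e δ : 𝔓.rational i) : 𝔓.radical i) * u) = ((δ : 𝔓.rational i) : 𝔓.radical i) * c.toEquiv u
  rw [MeasurableEquiv.coe_toEquiv]
  apply Subtype.ext
  change ((c ((c.symm δ : 𝔓.radical i) * u) : 𝔓.radical i) : 𝒢.Adelic) = ((δ : 𝔓.rational i) : 𝔓.radical i) * ((c u : 𝔓.radical i) : 𝒢.Adelic)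
  rw [hc, Subgroup.coe_mul, coe_symm_conj 𝔓 c hc, hc u]
  group

/-- **THE CONJUGATION LAW OF THE CONSTANT-TERM FUNCTIONAL.**  `𝒢` any adelic group datum, `N_i(𝔸) = 𝔓.radical i` a radical with a left Haar measure `ν_N`, `γ ∈ G(K)` (★ `arithmeticSubgroup`)
a rational element NORMALISING `N_i(𝔸)` through a measurable equivalence `c` (`c(u) = γuγ⁻¹`) which PRESERVES `ν_N` (modulus one — e.g. `γ` in the rational points of the
Levi of a unitary group, by the product formula), `𝓕` any fundamental domain of `N_i(K)`.  Then for every `ψ` on `G(𝔸) ⧸ Q` and every `x`: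
`∫_𝓕 ψ((xγu⁻¹)Q) dν_N(u) = ∫_𝓕 ψ((xu⁻¹)Q) dν_N(u)` — `CT_𝓕 ψ (x·γ) = CT_𝓕 ψ (x)`; classically `φ_P(γ⁻¹ g) = φ_P(g)`: with ★ p856838 (right-`N_i(𝔸)`-invariance) the constant
term is LEFT-`N(𝔸)P(F)`-invariant whenever the modulus is one on `P(F)`. [cite: MoeglinWaldspurger1995, I.2.6] [cite: BorelJacquet1979, §4.4] -/
theorem setIntegral_constantTerm_mul_eq_of_conj [BorelSpace (𝔓.radical i)] (ψ : 𝒢.automorphicQuotient → ℂ) (νN : Measure (𝔓.radical i))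
    [νN.IsMulLeftInvariant] [Countable (𝔓.rational i)] {γ : 𝒢.Adelic} (hγ : γ ∈ 𝒢.arithmeticSubgroup)
    (c : 𝔓.radical i ≃ᵐ 𝔓.radical i) (hc : ∀ u : 𝔓.radical i, ((c u : 𝔓.radical i) : 𝒢.Adelic) = γ * (u : 𝒢.Adelic) * γ⁻¹)
    (hcν : MeasurePreserving c νN νN) {𝓕 : Set (𝔓.radical i)} (h𝓕 : IsFundamentalDomain (𝔓.rational i) 𝓕 νN) (x : 𝒢.Adelic) :
    ∫ u in 𝓕, ψ (𝒢.toAutomorphicQuotient (x * γ * (u : 𝒢.Adelic)⁻¹)) ∂νN = ∫ u in 𝓕, ψ (𝒢.toAutomorphicQuotient (x * (u : 𝒢.Adelic)⁻¹)) ∂νN := by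
  set F : 𝔓.radical i → ℂ := fun w => ψ (𝒢.toAutomorphicQuotient (x * (w : 𝒢.Adelic)⁻¹)) with hF
  -- `(x γ u⁻¹) Q = (x γ u⁻¹ γ⁻¹) Q = (x (c u)⁻¹) Q`
  have h1 : (fun u : 𝔓.radical i => ψ (𝒢.toAutomorphicQuotient (x * γ * (u : 𝒢.Adelic)⁻¹))) = fun u => F (c u) := by
    funext u
    have hq : 𝒢.toAutomorphicQuotient (x * γ * (u : 𝒢.Adelic)⁻¹) = 𝒢.toAutomorphicQuotient (x * γ * (u : 𝒢.Adelic)⁻¹ * γ⁻¹) := by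
      change (QuotientGroup.mk (x * γ * (u : 𝒢.Adelic)⁻¹) : 𝒢.Adelic ⧸ 𝒢.quotientSubgroup) = QuotientGroup.mk (x * γ * (u : 𝒢.Adelic)⁻¹ * γ⁻¹)
      rw [QuotientGroup.mk_mul_of_mem _ (Subgroup.inv_mem _ (𝒢.arithmeticSubgroup_le_quotientSubgroup hγ))]
    have hinv : x * ((c u : 𝔓.radical i) : 𝒢.Adelic)⁻¹ = x * γ * (u : 𝒢.Adelic)⁻¹ * γ⁻¹ := by
      rw [hc u]
      group
    simp only [hF]
    rw [hq, hinv]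
  -- change of variables along the measure-preserving `c`, then independence of the fundamental domain
  have h2 : ∫ u in 𝓕, F (c u) ∂νN = ∫ w in c '' 𝓕, F w ∂νN := (hcν.setIntegral_image_emb c.measurableEmbedding F 𝓕).symm
  rw [h1, h2]
  exact setIntegral_constantTerm_eq_of_isFundamentalDomain 𝔓 ψ νN (isFundamentalDomain_image_conj 𝔓 νN hγ c hc hcν h𝓕) h𝓕 x

/-- **COROLLARY: invariance under the whole group generated** — if `x ↦ CT_𝓕 ψ (x)` is invariant under right multiplication by `γ` (§2) it is invariant under `γ⁻¹`
as well (apply §2 at `x γ⁻¹`), so under the subgroup of `Q` generated by the modulus-one normalisers together with `N_i(𝔸)` (★ p856838).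
[cite: MoeglinWaldspurger1995, I.2.6] -/
theorem setIntegral_constantTerm_mul_inv_eq_of_conj [BorelSpace (𝔓.radical i)] (ψ : 𝒢.automorphicQuotient → ℂ) (νN : Measure (𝔓.radical i))
    [νN.IsMulLeftInvariant] [Countable (𝔓.rational i)] {γ : 𝒢.Adelic} (hγ : γ ∈ 𝒢.arithmeticSubgroup)
    (c : 𝔓.radical i ≃ᵐ 𝔓.radical i) (hc : ∀ u : 𝔓.radical i, ((c u : 𝔓.radical i) : 𝒢.Adelic) = γ * (u : 𝒢.Adelic) * γ⁻¹)
    (hcν : MeasurePreserving c νN νN) {𝓕 : Set (𝔓.radical i)} (h𝓕 : IsFundamentalDomain (𝔓.rational i) 𝓕 νN) (x : 𝒢.Adelic) :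
    ∫ u in 𝓕, ψ (𝒢.toAutomorphicQuotient (x * γ⁻¹ * (u : 𝒢.Adelic)⁻¹)) ∂νN = ∫ u in 𝓕, ψ (𝒢.toAutomorphicQuotient (x * (u : 𝒢.Adelic)⁻¹)) ∂νN := by
  have h := setIntegral_constantTerm_mul_eq_of_conj 𝔓 ψ νN hγ c hc hcν h𝓕 (x * γ⁻¹)
  rw [inv_mul_cancel_right] at h
  exact h.symm

/-- **CONSUMER FORM (no equivalence to supply).**  If the rational `γ ∈ G(K)` normalises `N_i(𝔸)` (`γN_i(𝔸)γ⁻¹ ⊆ N_i(𝔸)` and `γ⁻¹N_i(𝔸)γ ⊆ N_i(𝔸)`) and the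
conjugation map `u ↦ γuγ⁻¹` of `N_i(𝔸)` preserves the Haar measure `ν_N` (MODULUS ONE, the hypothesis of record — product formula for the rational torus of `U(Φ_N)`), then
`CT_𝓕 ψ (x·γ) = CT_𝓕 ψ (x)` (the measurable equivalence of §2 is built here from the two inclusions; `G(𝔸)` a topological group, `N_i(𝔸)` with its Borel structure).
[cite: MoeglinWaldspurger1995, I.2.6] [cite: BorelJacquet1979, §4.4] -/
theorem setIntegral_constantTerm_mul_eq_of_normalizes [IsTopologicalGroup 𝒢.Adelic] [BorelSpace (𝔓.radical i)] (ψ : 𝒢.automorphicQuotient → ℂ)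
    (νN : Measure (𝔓.radical i)) [νN.IsMulLeftInvariant] [Countable (𝔓.rational i)] {γ : 𝒢.Adelic} (hγ : γ ∈ 𝒢.arithmeticSubgroup)
    (hN : ∀ u : 𝔓.radical i, γ * (u : 𝒢.Adelic) * γ⁻¹ ∈ 𝔓.radical i) (hN' : ∀ u : 𝔓.radical i, γ⁻¹ * (u : 𝒢.Adelic) * γ ∈ 𝔓.radical i)
    (hmod : MeasurePreserving (fun u : 𝔓.radical i => (⟨γ * (u : 𝒢.Adelic) * γ⁻¹, hN u⟩ : 𝔓.radical i)) νN νN)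
    {𝓕 : Set (𝔓.radical i)} (h𝓕 : IsFundamentalDomain (𝔓.rational i) 𝓕 νN) (x : 𝒢.Adelic) :
    ∫ u in 𝓕, ψ (𝒢.toAutomorphicQuotient (x * γ * (u : 𝒢.Adelic)⁻¹)) ∂νN = ∫ u in 𝓕, ψ (𝒢.toAutomorphicQuotient (x * (u : 𝒢.Adelic)⁻¹)) ∂νN := by
  -- the conjugation as a measurable equivalence of `N_i(𝔸)`
  have hmeas : Measurable fun u : 𝔓.radical i => (⟨γ * (u : 𝒢.Adelic) * γ⁻¹, hN u⟩ : 𝔓.radical i) :=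
    (((continuous_const.mul continuous_subtype_val).mul continuous_const).subtype_mk _).measurable
  have hmeas' : Measurable fun w : 𝔓.radical i => (⟨γ⁻¹ * (w : 𝒢.Adelic) * γ, hN' w⟩ : 𝔓.radical i) :=
    (((continuous_const.mul continuous_subtype_val).mul continuous_const).subtype_mk _).measurable
  let c : 𝔓.radical i ≃ᵐ 𝔓.radical i :=
    { toFun := fun u => ⟨γ * (u : 𝒢.Adelic) * γ⁻¹, hN u⟩
      invFun := fun w => ⟨γ⁻¹ * (w : 𝒢.Adelic) * γ, hN' w⟩
      left_inv := fun u => Subtype.ext (by change γ⁻¹ * (γ * (u : 𝒢.Adelic) * γ⁻¹) * γ = u; group)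
      right_inv := fun w => Subtype.ext (by change γ * (γ⁻¹ * (w : 𝒢.Adelic) * γ) * γ⁻¹ = w; group)
      measurable_toFun := hmeas
      measurable_invFun := hmeas' }
  exact setIntegral_constantTerm_mul_eq_of_conj 𝔓 ψ νN hγ c (fun u => rfl) hmod h𝓕 x

end Conj

end Summit.HodgeConjecture.HodgeConjecture.Cruxes.H413.K2E1ConstantTermTorusU

end
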